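import Summits.Ventures.CertifiedManyBodySolver.Theorems.M3x2EdgeSplitSymReplayOutRouteHSem
import Mathlib.Data.List.SplitBy
import HarnessLib

/-!
# SymReplay checker — WORD-LEVEL FACTOR ROWS («η»): one Gram dot per DISTINCT (representative word, basis word) pair,
closed through the tree's SEMANTIC skeleton `…OutRouteHSem`

(team lb-sym, cell hub-lb; SPEC TEXT by the pen hub-lb-sym-plan-1 g5 for EBUDGET-600 rev 4 §11b lever (η) = ETA-symeng3 §2–§3;
ADDITIVE on `…OutRouteMF` / `…OutRoutePF` (hub-lb-sym-eng-4), `…OutRouteHSem` and T20c `…OutRouteM` (hub-lb-sym-eng-3); nothing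
landed is touched.)

WHY.  In the landed E-class enumerator `shareRFastMF` every product HIT `(term t of s_i†) × (term x of q_j)` that survives the
routing tests costs one Gram dot `⟨L_i, L_j⟩` (`stepOpt`), i.e. `P_R ≈ 3.34e8` dots of mean length `r̄ ≈ 102.6` at E₁ (e7-census).
The exact bilinear identity
  `Σ_{i,j} ⟨L_i, L_j⟩ · s_i† q_j = Σ_{(u,w)} ⟨ρ_u, σ_w⟩ · u w`,  `ρ_u := Σ_{(i,c) : (c,u) ∈ s_i†} c · L_i`,  `σ_w := Σ_{(j,d) : (d,w) ∈ q_j} d · L_j`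
over DISTINCT adjoint-representative words `u` and DISTINCT basis words `w` needs one dot per distinct word pair
(`P_scatter = 0.658 · P_R` at E₁) and emits one term per pair.  The regrouped share is NOT a permutation of the spec share
`shareR` (coefficients are re-associated across terms with the same word), so it closes through the tree's SEMANTIC skeleton
`energyDensity_ge_of_outroutePSem0` (hub-lb-sym-eng-3 g3, p665136): word inclusion `hW` + operator equality `hsem`.

CONTENTS.  Everything is GENERIC in a comparator `le` on tagged terms (section variable; `wordLe` = by `wordLt`, `keyLe key` = by
an integer key — the engine's choice, see the docstring of `wordLe`; soundness holds for ANY `le`).  (a) the η enumerator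
(executable): `tagRep`, `wsort`/`wgroup` (sort by `le`, group adjacent equal words by `wordEq`), `drow n ch` (the word-level row
`Σ c · L` of a group, as an ASCENDING full-support row of width `n = colBound`, via `rowCoef`), `dgroup`, `rowFastFη` (ends in the
landed `stepOpt`), `shareRWithMFη`, **`shareRFastMFη le S K gbs hm κ₂ J L i f`** (module signature = `shareRFastMF`'s + `le`);  (b) `hsem`: the bridge **`polyOp_shareRWithMFη : polyOp Λ' (shareRWithMFη …) = polyOp Λ'
(shareRWithMF …)`** (rows ascending) and `polyOp_shareRFastMFη`;  (c) `hW`: **`words_shareRFastMFη`** (every word of the η share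
is a word of the MF share: from `⟨ρ_u, σ_w⟩ ≠ 0` a pair `(i ∋ u, j ∋ w)` with `⟨L_i, L_j⟩ ≠ 0` is extracted, `sdot_drow_drow`),
and the closing **`energyDensity_ge_of_outroutePMFη0`** (bare packed facts over `J·L` modules; hypotheses = `…PMF0`'s exactly —
rows ascending comes from `hwf` by `rowsAsc_of_wellFormed`, hub-lb-sym-ref-2 g2's lemma);
(d) the ENGINE form: `drowA` (one `Array` scatter-accumulate per group, cost `Σ_{y∈ch} |L_y| + n` instead of `n·|ch|·|L|`),
**`drowA_eq_drow` (unconditional: `rowCoef` sums a whole column)**, `dgroupA`/`shareRWithMFηA`/**`shareRFastMFηA`** with the LIST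
equalities `shareRFastMFηA_eq`, two kernel `decide` toy models, and the engine closing **`energyDensity_ge_of_outroutePMFηA0`**
(same hypotheses; the module files evaluate `shareRFastMFηA`).

ENGINE NOTES (statement-neutral): integer / dense rows (`…MFZ`/`…MFD`) lift exactly as for `stepOpt` (`sdot_liftRow`), since
`rowFastFη` ends in the same `stepOpt` and `drow` rows are ascending full-support rows with columns `< colBound` (`rowAsc_drow`,
`drow_bound`) — on MFD's dense rows `drowA`'s accumulator IS the dense row, so the `range n` re-listing can be skipped by a
`ddot`-level twin of `rowFastFη`.  Rows ascending (needed by the bridge: on a non-ascending row the merge-walk `sdot` under-counts)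
is implied by `wellFormed K.expand` (`rowsAsc_of_wellFormed`), so no side fact is taken.  The tree's abstract identity `EtaAlgebra.eta_regroup` (hub-lb-sym-eng-3 g3,
p665768) is the `Fintype` form of (b)'s `enum_sum_eq_theta`∘`sum_smul_fiber`; this file proves the list-level instance directly,
so (b) does not depend on it (either route closes `hsem`).

PROOF DEVICE for (b): both enumerations are evaluated to `Σ_y Σ_x (⟨L_y,L_x⟩ c_y c_x) • opT u_y w_x` (`polyOp_enum_eq`;
the `sdot = 0` drop of `stepOpt` is a `0 •`), the dot is expanded column-wise (`sdot_eq_sum`, rows ascending of width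
`≤ colBound`) and each column regrouped by word fibers (`sum_smul_fiber`) into `Σ_k Σ_v Σ_w (wmu L₁ v k · wmu L₂ w k) • opT v w`
(`enum_sum_eq_theta`); grouping preserves every word fiber (`wmu_dgroup`: `mergeSort` permutation + `splitBy` chunks of
constant word + `rowCoef_drow`).  STATUS (farm, 2026-08-28): the whole file elaborates, 0 `sorry`, 0 warnings; axiom closure
of `energyDensity_ge_of_outroutePMFη0` / `…PMFηA0` = {propext, Classical.choice, Quot.sound}.  NOT proposed (registry / announce
rules of the cell): an engine that adopts η benches `shareRFastMFηA` (or its MFD twin), copies (a)–(d) and proposes under its own name.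

HONEST FRAMING: an enumeration COST lever and its soundness plumbing; no certificate lands by this file; no bound of record
moves (#529 = −0.8295699476 stays outside Lean; tree floor −0.8942613047 computational); `LowerEdge_ge_m83o100` stays met BY
VALUE only; no summit or crux statement is proved here; nothing here predicts superconductivity.
-/

namespace Summit.Ventures.CertifiedManyBodySolver.Theorems.SymReplay

open Literature.MathematicalPhysics.QuantumLattice
open Literature.MathematicalPhysics.QuantumLattice.HubbardWave0
open Literature.MathematicalPhysics.QuantumLattice.ThermodynamicLimit
open Literature.Probability.LatticeModels
open Literature.MathematicalPhysics.QuantumManyBody.StateRelaxation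
open Summit.Ventures.CertifiedManyBodySolver.Theorems.WardSlot

/-! ##### (a) Word-level factor rows: the η enumerator -/

section Generic

/-! The grouping machinery is GENERIC in the row payload `ρ` (`List (ℚ × ℕ)` sparse rows here; an engine's dense-ℤ twin reuses
`tagRep`/`wsort`/`wgroup` and their four lemmas verbatim at its own `ρ` — hub-lb-sym-eng-3 g4's request l.2236). -/
variable {ρ : Type} (le : (ρ × (ℚ × Word)) → (ρ × (ℚ × Word)) → Bool)

/-- Tagged representative terms of a block: `(L_i, (c, u†))` for every term `(c, u†)` of every `s_i†` (= `padj s_i`). -/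
def tagRep (ra : List (QPoly × ρ)) : List (ρ × (ℚ × Word)) :=
  ra.flatMap fun a => (padj a.1).map fun t => (a.2, t)

/-- Comparators on tagged terms.  ANY comparator `le` is SOUND for everything below (the proofs use only `mergeSort`'s
permutation and `splitBy`'s constant-word chunks); it only decides how many equal words end up adjacent, i.e. the gain.
`wordLe` = by the tree's `wordLt` (interpreted structural compares); `keyLe key` = by an integer key of the word (native `Nat`
compares — the ENGINE choice at E₁, where one call sorts ≈ 3.9e5 tagged terms: ≈ 4.6e6 compares, seconds natively vs tens of
seconds through `wordLt`; an injective key (e.g. a packed-word code) groups maximally, a hash key still groups soundly).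
NB (hub-lb-sym-ref-2 g2): `List.mergeSort` is well-founded recursion — not `decide`-reducible; nothing below asks the kernel to run it. -/
def wordLe : (ρ × (ℚ × Word)) → (ρ × (ℚ × Word)) → Bool := fun y y' => !wordLt y'.2.2 y.2.2

def keyLe (key : Word → ℕ) : (ρ × (ℚ × Word)) → (ρ × (ℚ × Word)) → Bool :=
  fun y y' => Nat.ble (key y.2.2) (key y'.2.2)

/-- Sort tagged terms by the comparator `le`. -/
def wsort (L : List (ρ × (ℚ × Word))) : List (ρ × (ℚ × Word)) :=
  L.mergeSort le

/-- Group ADJACENT tagged terms with equal words (after `wsort`: one group per run of equal words). -/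
def wgroup (L : List (ρ × (ℚ × Word))) : List (List (ρ × (ℚ × Word))) :=
  (wsort le L).splitBy fun y y' => wordEq y.2.2 y'.2.2

/-- In a group all words are equal. -/
theorem isChain_words_const : ∀ (l : List (ρ × (ℚ × Word))),
    l.IsChain (fun a b => a.2.2 = b.2.2) → ∀ y ∈ l, ∀ y' ∈ l, y.2.2 = y'.2.2
  | [], _ => by simp
  | [a], _ => by simp
  | a :: b :: l, h => by
    rw [List.isChain_cons_cons] at h
    have ih := isChain_words_const (b :: l) h.2
    have ha : ∀ y ∈ a :: b :: l, y.2.2 = b.2.2 := fun y hy => by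
      rcases List.mem_cons.1 hy with hya | hy
      · rw [hya]; exact h.1
      · exact ih y hy b List.mem_cons_self
    intro y hy y' hy'
    rw [ha y hy, ha y' hy']

/-- The groups of `wgroup le L`: nonempty, constant word. -/
theorem wgroup_spec (L : List (ρ × (ℚ × Word))) :
    ∀ ch ∈ wgroup le L, ch ≠ [] ∧ ∀ y ∈ ch, ∀ y' ∈ ch, y.2.2 = y'.2.2 := by
  intro ch hch
  refine ⟨List.ne_nil_of_mem_splitBy hch, isChain_words_const ch ?_⟩
  exact (List.isChain_of_mem_splitBy hch).imp fun a b h => (wordEq_iff _ _).1 h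

/-- The groups flatten to a permutation of `L`. -/
theorem wgroup_flatten_perm (L : List (ρ × (ℚ × Word))) : (wgroup le L).flatten.Perm L := by
  rw [wgroup, List.flatten_splitBy]; exact List.mergeSort_perm _ _

/-- Members of a group are members of the list. -/
theorem mem_of_mem_wgroup {L ch : List (ρ × (ℚ × Word))} {y : ρ × (ℚ × Word)}
    (hch : ch ∈ wgroup le L) (hy : y ∈ ch) : y ∈ L :=
  (wgroup_flatten_perm le L).mem_iff.1 (List.mem_flatten.2 ⟨ch, hch, hy⟩)

/-- Rows of tagged representative terms are the given rows. -/
theorem tagRep_row {ra : List (QPoly × ρ)} {y : ρ × (ℚ × Word)} (h : y ∈ tagRep ra) :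
    ∃ a ∈ ra, y.1 = a.2 ∧ y.2 ∈ padj a.1 := by
  rw [tagRep, List.mem_flatMap] at h
  obtain ⟨a, ha, h⟩ := h
  rw [List.mem_map] at h
  obtain ⟨t, ht, rfl⟩ := h
  exact ⟨a, ha, rfl, ht⟩

end Generic

variable (le : (List (ℚ × ℕ) × (ℚ × Word)) → (List (ℚ × ℕ) × (ℚ × Word)) → Bool)

/-- **The word-level row of a group** `Σ_{(L,(c,·)) ∈ ch} c · L`, as the full-support ascending row of width `n`
(SPEC via `rowCoef`; an engine's scatter-accumulate must return this list). -/
def drow (n : ℕ) (ch : List (List (ℚ × ℕ) × (ℚ × Word))) : List (ℚ × ℕ) :=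
  (List.range n).map fun k => ((ch.map fun y => y.2.1 * rowCoef y.1 k).sum, k)

/-- The word-level tagged term of a (nonempty) group: `(ρ_u, (1, u))`, `u` = the group's word. -/
def dhead (n : ℕ) : List (List (ℚ × ℕ) × (ℚ × Word)) → Option (List (ℚ × ℕ) × (ℚ × Word))
  | [] => none
  | y :: ys => some (drow n (y :: ys), ((1 : ℚ), y.2.2))

/-- **Word-level factor rows**: one tagged term `(ρ_u, (1, u))` per group of `L` (per distinct word after `wsort`). -/
def dgroup (n : ℕ) (L : List (List (ℚ × ℕ) × (ℚ × Word))) : List (List (ℚ × ℕ) × (ℚ × Word)) :=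
  (wgroup le L).filterMap (dhead n)

section Eta

variable {M : Type} [DecidableEq M] [Hashable M]

/-- **One word-level representative row** `y = (ρ_u, (1, u))` against the bucket map of the word-level basis rows: per target
`mt`, the bucket of `mt − mom u`, the secondary test on the product word FIRST, then the same `stepOpt` (one dot `⟨ρ_u, σ_w⟩`). -/
def rowFastFη (S : MomSpec M) (y : List (ℚ × ℕ) × (ℚ × Word))
    (wmap : Std.HashMap M (List (List (ℚ × ℕ) × (ℚ × Word)))) (m s : ℚ) (T : List M) (P₂ : Word → Bool) : QPoly :=
  T.flatMap fun mt =>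
    (wmap.getD (S.sub mt (mom S y.2.2)) []).filterMap fun x =>
      if P₂ (y.2.2 ++ x.2.2) then stepOpt ([], y.1) m s y.2 x else none

/-- **R-part of sub-module `(i, f)` by word-level factor rows**: per block, width `n = colBound`, ONE bucket map of the grouped
basis rows `(σ_w, (1, w))`, one `rowFastFη` per grouped representative row `(ρ_u, (1, u))`. -/
def shareRWithMFη (S : MomSpec M) (K : SymCertR) (gbs : List (List QPoly)) (T : List M) (P₂ : Word → Bool) : QPoly :=
  (K.gramR.zip gbs).flatMap fun Bg =>
    let n := colBound (toGramBlock Bg.1)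
    let wmap := bucketOf S (dgroup le n (wflat (Bg.2.zip Bg.1.rows)))
    (dgroup le n (tagRep (Bg.1.reps.zip Bg.1.rows))).flatMap fun y => rowFastFη S y wmap Bg.1.moves.length Bg.1.scale T P₂

/-- **Sub-module `(i, f)`'s share by word-level factor rows** (base and `gramM` parts exactly as `shareRFastMF`). -/
def shareRFastMFη (S : MomSpec M) (K : SymCertR) (gbs : List (List QPoly)) (hm : MomTable M) (κ₂ : Word → ℕ)
    (J L i f : ℕ) : QPoly :=
  let P := wordPred (inSlotW (momKey S hm) J i)
  let P₂ : Word → Bool := fun w => κ₂ w % L == f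
  (baseShareF K.toSymCert P).filter (wordPred P₂) ++
  ((pscale (-1) (K.gramM.flatMap fun B => (gramBlockPoly B).filter P)).filter (wordPred P₂) ++
    shareRWithMFη le S K gbs (targetsM hm J i) P₂)

/-! ##### (b) The bridge (`hsem`): the η share has the operator value of the MF share -/

/-! ###### (b1) list algebra -/

omit [DecidableEq M] [Hashable M] in
/-- Swapping two list sums. -/
theorem list_sum_map_swap {α β N : Type*} [AddCommMonoid N] (l₁ : List α) (l₂ : List β) (f : α → β → N) :
    (l₁.map fun a => (l₂.map fun b => f a b).sum).sum = (l₂.map fun b => (l₁.map fun a => f a b).sum).sum := by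
  induction l₁ with
  | nil => simp
  | cons a l₁ ih => simp only [List.map_cons, List.sum_cons, ih, List.sum_map_add]

omit [DecidableEq M] [Hashable M] in
/-- A `Finset` sum out of a list sum. -/
theorem list_sum_map_finset_sum {α ι N : Type*} [AddCommMonoid N] (l : List α) (s : Finset ι) (f : α → ι → N) :
    (l.map fun a => ∑ i ∈ s, f a i).sum = ∑ i ∈ s, (l.map fun a => f a i).sum := by
  induction l with
  | nil => simp
  | cons a l ih => simp only [List.map_cons, List.sum_cons, ih, Finset.sum_add_distrib]

omit [DecidableEq M] [Hashable M] in
/-- A filtered list sum as a sum of `ite`s. -/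
theorem list_sum_map_filter {α N : Type*} [AddCommMonoid N] (l : List α) (p : α → Bool) (f : α → N) :
    ((l.filter p).map f).sum = (l.map fun a => if p a = true then f a else 0).sum := by
  induction l with
  | nil => simp
  | cons a l ih =>
    rw [List.filter_cons]
    by_cases h : p a = true
    · simp [h, ih]
    · simp [h, ih]

omit [DecidableEq M] [Hashable M] in
/-- `flatMap` after `map`. -/
theorem flatMap_map' {α β γ : Type*} (l : List α) (f : α → β) (g : β → List γ) :
    (l.map f).flatMap g = l.flatMap fun a => g (f a) := by
  induction l with
  | nil => rfl
  | cons a l ih => rw [List.map_cons, List.flatMap_cons, List.flatMap_cons, ih]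

omit [DecidableEq M] [Hashable M] in
/-- `flatMap` after `flatMap`. -/
theorem flatMap_flatMap' {α β γ : Type*} (l : List α) (f : α → List β) (g : β → List γ) :
    (l.flatMap f).flatMap g = l.flatMap fun a => (f a).flatMap g := by
  induction l with
  | nil => rfl
  | cons a l ih => rw [List.flatMap_cons, List.flatMap_append, List.flatMap_cons, ih]

omit [DecidableEq M] [Hashable M] in
/-- **Fiber regrouping**: a list sum of `φ a • G (key a)` is a sum over key values of the fiber sums. -/
theorem sum_smul_fiber {α β : Type*} [DecidableEq β] (Λ' : Finset (Site 2)) (l : List α) (key : α → β) (φ : α → ℚ)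
    (G : β → FermionOp Λ') (V : Finset β) (hV : ∀ a ∈ l, key a ∈ V) :
    (l.map fun a => ((φ a : ℚ) : ℂ) • G (key a)).sum =
      ∑ v ∈ V, (((l.map fun a => if key a = v then φ a else 0).sum : ℚ) : ℂ) • G v := by
  induction l with
  | nil => simp
  | cons a l ih =>
    rw [List.map_cons, List.sum_cons, ih (fun b hb => hV b (List.mem_cons_of_mem _ hb))]
    simp only [List.map_cons, List.sum_cons, Rat.cast_add, add_smul, Finset.sum_add_distrib]
    congr 1
    rw [← Finset.sum_ite_eq V (key a) (fun v => ((φ a : ℚ) : ℂ) • G v) |>.trans (if_pos (hV a List.mem_cons_self))]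
    refine Finset.sum_congr rfl fun v _ => ?_
    by_cases h : key a = v
    · rw [if_pos h, if_pos h]
    · rw [if_neg h, if_neg h, Rat.cast_zero, zero_smul]

/-! ###### (b2) the word-level rows: ascending, bounded, and their fibers -/

omit [DecidableEq M] [Hashable M] in
/-- Rows indexed by a `range'` are ascending. -/
theorem rowAsc_map_range' (f : ℕ → ℚ) : ∀ (n s : ℕ), rowAsc ((List.range' s n).map fun k => (f k, k)) = true
  | 0, _ => rfl
  | 1, s => rfl
  | n + 2, s => by
    have ih := rowAsc_map_range' f (n + 1) (s + 1)
    rw [List.range'_succ, List.map_cons] at ih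
    rw [List.range'_succ, List.range'_succ, List.map_cons, List.map_cons, rowAsc_cons_cons, Bool.and_eq_true,
      decide_eq_true_eq]
    exact ⟨Nat.lt_succ_self s, ih⟩

omit [DecidableEq M] [Hashable M] in
/-- `drow` is ascending. -/
theorem rowAsc_drow (n : ℕ) (ch : List (List (ℚ × ℕ) × (ℚ × Word))) : rowAsc (drow n ch) = true := by
  rw [drow, List.range_eq_range']; exact rowAsc_map_range' _ n 0

omit [DecidableEq M] [Hashable M] in
/-- `drow`'s columns are `< n`. -/
theorem drow_bound (n : ℕ) (ch : List (List (ℚ × ℕ) × (ℚ × Word))) : ∀ e ∈ drow n ch, e.2 < n := by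
  intro e he
  rw [drow, List.mem_map] at he
  obtain ⟨k, hk, rfl⟩ := he
  exact List.mem_range.1 hk

omit [DecidableEq M] [Hashable M] in
/-- **The coefficient of `drow` at column `k < n`** is the group's weighted coefficient sum. -/
theorem rowCoef_drow (n : ℕ) (ch : List (List (ℚ × ℕ) × (ℚ × Word))) {k : ℕ} (hk : k < n) :
    rowCoef (drow n ch) k = (ch.map fun y => y.2.1 * rowCoef y.1 k).sum := by
  rw [rowCoef, drow, List.map_map, ← List.sum_toFinset _ List.nodup_range, List.toFinset_range]
  simp only [Function.comp_def]
  rw [Finset.sum_ite_eq' (Finset.range n) k, if_pos (Finset.mem_range.2 hk)]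

omit [DecidableEq M] [Hashable M] in
/-- **Membership in `dgroup`**: a word-level term is `(drow n ch, (1, u))` for a group `ch` of terms of `L` with word `u`. -/
theorem mem_dgroup {n : ℕ} {L : List (List (ℚ × ℕ) × (ℚ × Word))} {y : List (ℚ × ℕ) × (ℚ × Word)}
    (h : y ∈ dgroup le n L) : ∃ ch ∈ wgroup le L, y.1 = drow n ch ∧ ∃ y₀ ∈ ch, y₀ ∈ L ∧ y.2 = (1, y₀.2.2) := by
  rw [dgroup, List.mem_filterMap] at h
  obtain ⟨ch, hch, hy⟩ := h
  refine ⟨ch, hch, ?_⟩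
  match ch, hch, hy with
  | [], _, hy => exact absurd hy (by simp [dhead])
  | y₀ :: ys, hch, hy =>
    simp only [dhead, Option.some.injEq] at hy
    subst hy
    exact ⟨rfl, y₀, List.mem_cons_self,
      (wgroup_flatten_perm le L).mem_iff.1 (List.mem_flatten.2 ⟨_, hch, List.mem_cons_self⟩), rfl⟩

omit [DecidableEq M] [Hashable M] in
/-- Word-level rows are ascending with columns `< n`. -/
theorem dgroup_rows {n : ℕ} {L : List (List (ℚ × ℕ) × (ℚ × Word))} :
    ∀ y ∈ dgroup le n L, rowAsc y.1 = true ∧ ∀ e ∈ y.1, e.2 < n := by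
  intro y hy
  obtain ⟨ch, -, h1, -⟩ := mem_dgroup le hy
  rw [h1]
  exact ⟨rowAsc_drow n ch, drow_bound n ch⟩

/-- The word-fiber coefficient of a tagged list at column `k`: `Σ_{(L,(c,u)) : u = v} c · L_k`. -/
def wmu [DecidableEq Word] (L : List (List (ℚ × ℕ) × (ℚ × Word))) (v : Word) (k : ℕ) : ℚ :=
  (L.map fun y => if y.2.2 = v then y.2.1 * rowCoef y.1 k else 0).sum

omit [DecidableEq M] [Hashable M] in
/-- **Grouping preserves every word fiber** (columns `< n`). -/
theorem wmu_dgroup [DecidableEq Word] (n : ℕ) (L : List (List (ℚ × ℕ) × (ℚ × Word))) (v : Word) {k : ℕ} (hk : k < n) :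
    wmu (dgroup le n L) v k = wmu L v k := by
  have hg : ∀ C : List (List (List (ℚ × ℕ) × (ℚ × Word))), (∀ ch ∈ C, ch ≠ [] ∧ ∀ y ∈ ch, ∀ y' ∈ ch, y.2.2 = y'.2.2) →
      ((C.filterMap (dhead n)).map fun y => if y.2.2 = v then y.2.1 * rowCoef y.1 k else 0).sum =
        (C.map fun ch => (ch.map fun y => if y.2.2 = v then y.2.1 * rowCoef y.1 k else 0).sum).sum := by
    intro C
    induction C with
    | nil => intro; rfl
    | cons ch C ih =>
      intro hC
      have hC' := fun c hc => hC c (List.mem_cons_of_mem _ hc)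
      obtain ⟨hne, hconst⟩ := hC ch List.mem_cons_self
      match ch, hne, hconst with
      | y₀ :: ys, _, hconst =>
        rw [List.filterMap_cons_some (by rfl), List.map_cons, List.sum_cons, List.map_cons, List.sum_cons, ih hC']
        congr 1
        simp only [rowCoef_drow n _ hk, one_mul]
        by_cases h0 : y₀.2.2 = v
        · rw [if_pos h0]
          exact congrArg List.sum (List.map_congr_left fun y hy => by
            rw [if_pos ((hconst y hy y₀ List.mem_cons_self).trans h0)])
        · rw [if_neg h0]
          symm
          rw [List.sum_eq_zero]
          intro q hq
          rw [List.mem_map] at hq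
          obtain ⟨y, hy, rfl⟩ := hq
          rw [if_neg (fun h => h0 ((hconst y₀ List.mem_cons_self y hy).trans h))]
  rw [wmu, wmu, dgroup, hg _ (wgroup_spec le L), ← (wgroup_flatten_perm le L).map _ |>.sum_eq, List.map_flatten, List.sum_flatten,
    List.map_map]
  rfl

/-! ###### (b3) the value of a bucketed enumeration -/

/-- Match-and-keep test of a (representative word, basis word, target) triple. -/
def bmatch (S : MomSpec M) (P₂ : Word → Bool) (v w : Word) (mt : M) : Bool :=
  decide (mom S w = S.sub mt (mom S v)) && P₂ (v ++ w)

/-- The operator a word pair contributes per unit Gram coefficient: `Σ_{mt ∈ T : match ∧ keep} κ₀ • (v w)`. -/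
noncomputable def opT (Λ' : Finset (Site 2)) (S : MomSpec M) (T : List M) (P₂ : Word → Bool) (κ₀ : ℚ) (v w : Word) :
    FermionOp Λ' :=
  (T.map fun mt => if bmatch S P₂ v w mt = true then ((κ₀ : ℚ) : ℂ) • wordOp Λ' (v ++ w) else 0).sum

omit [Hashable M] in
/-- The value of one bucket scan (the `sdot = 0` drop contributes `0 •`). -/
theorem polyOp_filterMap_step (Λ' : Finset (Site 2)) (m s : ℚ) (P₂ : Word → Bool) (y : List (ℚ × ℕ) × (ℚ × Word)) :
    ∀ l : List (List (ℚ × ℕ) × (ℚ × Word)),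
      polyOp Λ' (l.filterMap fun x => if P₂ (y.2.2 ++ x.2.2) then stepOpt ([], y.1) m s y.2 x else none) =
        (l.map fun x => if P₂ (y.2.2 ++ x.2.2) = true then
          ((-1 * (m * (s * sdot y.1 x.1)) * (y.2.1 * x.2.1) : ℚ) : ℂ) • wordOp Λ' (y.2.2 ++ x.2.2) else 0).sum
  | [] => by simp
  | x :: l => by
    rw [List.filterMap_cons, List.map_cons, List.sum_cons, ← polyOp_filterMap_step Λ' m s P₂ y l]
    by_cases hP : P₂ (y.2.2 ++ x.2.2) = true
    · simp only [hP, if_true, stepOpt]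
      by_cases h0 : sdot y.1 x.1 = 0
      · simp [h0]
      · rw [if_neg h0, polyOp_cons]
    · simp [hP]

/-- **The value of a bucketed enumeration** `Σ_y rowFastFη y`: a double sum of `(⟨L_y, L_x⟩ c_y c_x) • opT u_y w_x`. -/
theorem polyOp_enum_eq (Λ' : Finset (Site 2)) (S : MomSpec M) (L₁ L₂ : List (List (ℚ × ℕ) × (ℚ × Word))) (m s : ℚ)
    (T : List M) (P₂ : Word → Bool) :
    polyOp Λ' (L₁.flatMap fun y => rowFastFη S y (bucketOf S L₂) m s T P₂) =
      (L₁.map fun y => (L₂.map fun x =>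
        ((sdot y.1 x.1 * (y.2.1 * x.2.1) : ℚ) : ℂ) • opT Λ' S T P₂ (-1 * (m * s)) y.2.2 x.2.2).sum).sum := by
  rw [polyOp_flatMap]
  refine congrArg List.sum (List.map_congr_left fun y _ => ?_)
  rw [rowFastFη, polyOp_flatMap]
  have h1 : (T.map fun mt => polyOp Λ' (((bucketOf S L₂).getD (S.sub mt (mom S y.2.2)) []).filterMap fun x =>
      if P₂ (y.2.2 ++ x.2.2) then stepOpt ([], y.1) m s y.2 x else none)) =
      T.map fun mt => (L₂.map fun x => if decide (mom S x.2.2 = S.sub mt (mom S y.2.2)) = true then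
        (if P₂ (y.2.2 ++ x.2.2) = true then
          ((-1 * (m * (s * sdot y.1 x.1)) * (y.2.1 * x.2.1) : ℚ) : ℂ) • wordOp Λ' (y.2.2 ++ x.2.2) else 0) else 0).sum := by
    refine List.map_congr_left fun mt _ => ?_
    rw [bucketOf_getD, List.filterMap_reverse, polyOp_eq_evalP] at *
    rw [← polyOp_eq_evalP, show ∀ p : QPoly, polyOp Λ' p.reverse = polyOp Λ' p from fun p => by
      rw [polyOp, polyOp, List.map_reverse, List.sum_reverse], polyOp_filterMap_step, list_sum_map_filter]
  rw [h1, list_sum_map_swap]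
  refine congrArg List.sum (List.map_congr_left fun x _ => ?_)
  rw [opT, List.smul_sum, List.map_map]
  refine congrArg List.sum (List.map_congr_left fun mt _ => ?_)
  simp only [Function.comp_def, bmatch, Bool.and_eq_true, decide_eq_true_eq]
  by_cases hm : mom S x.2.2 = S.sub mt (mom S y.2.2)
  · by_cases hP : P₂ (y.2.2 ++ x.2.2) = true
    · rw [if_pos hm, if_pos hP, if_pos ⟨hm, hP⟩, smul_smul, ← Rat.cast_mul]
      congr 2
      ring
    · rw [if_pos hm, if_neg hP, if_neg (fun h => hP h.2), smul_zero]
  · rw [if_neg hm, if_neg (fun h => hm h.1), smul_zero]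

/-! ###### (b4) the bilinear expansion and the regrouping identity -/

omit [DecidableEq M] [Hashable M] in
/-- **Bilinear expansion**: with ascending rows of width `≤ n`, the double sum depends on the lists only through their word
fibers `wmu`. -/
theorem enum_sum_eq_theta [DecidableEq Word] (Λ' : Finset (Site 2)) (L₁ L₂ : List (List (ℚ × ℕ) × (ℚ × Word))) (n : ℕ)
    (h₁ : ∀ y ∈ L₁, rowAsc y.1 = true ∧ ∀ e ∈ y.1, e.2 < n) (h₂ : ∀ x ∈ L₂, rowAsc x.1 = true ∧ ∀ e ∈ x.1, e.2 < n)
    (V W : Finset Word) (hV : ∀ y ∈ L₁, y.2.2 ∈ V) (hW : ∀ x ∈ L₂, x.2.2 ∈ W) (Φ : Word → Word → FermionOp Λ') :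
    (L₁.map fun y => (L₂.map fun x => ((sdot y.1 x.1 * (y.2.1 * x.2.1) : ℚ) : ℂ) • Φ y.2.2 x.2.2).sum).sum =
      ∑ k ∈ Finset.range n, ∑ v ∈ V, ∑ w ∈ W, ((wmu L₁ v k * wmu L₂ w k : ℚ) : ℂ) • Φ v w := by
  have hsd : ∀ y ∈ L₁, ∀ x ∈ L₂, sdot y.1 x.1 * (y.2.1 * x.2.1) =
      ∑ k ∈ Finset.range n, (y.2.1 * rowCoef y.1 k) * (x.2.1 * rowCoef x.1 k) := by
    intro y hy x hx
    rw [sdot_eq_sum n y.1 x.1 (h₁ y hy).1 (h₂ x hx).1 (h₁ y hy).2 (h₂ x hx).2,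
      Fin.sum_univ_eq_sum_range (fun k => rowCoef y.1 k * rowCoef x.1 k) n, Finset.sum_mul]
    exact Finset.sum_congr rfl fun k _ => by ring
  have e1 : (L₁.map fun y => (L₂.map fun x => ((sdot y.1 x.1 * (y.2.1 * x.2.1) : ℚ) : ℂ) • Φ y.2.2 x.2.2).sum).sum =
      (L₁.map fun y => (L₂.map fun x => ∑ k ∈ Finset.range n,
        (((y.2.1 * rowCoef y.1 k) * (x.2.1 * rowCoef x.1 k) : ℚ) : ℂ) • Φ y.2.2 x.2.2).sum).sum := by
    refine congrArg List.sum (List.map_congr_left fun y hy => congrArg List.sum (List.map_congr_left fun x hx => ?_))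
    rw [hsd y hy x hx, Rat.cast_sum, Finset.sum_smul]
  rw [e1]
  simp only [list_sum_map_finset_sum]
  refine Finset.sum_congr rfl fun k _ => ?_
  have e2 : (L₁.map fun y => (L₂.map fun x =>
      (((y.2.1 * rowCoef y.1 k) * (x.2.1 * rowCoef x.1 k) : ℚ) : ℂ) • Φ y.2.2 x.2.2).sum).sum =
      (L₁.map fun y => (((y.2.1 * rowCoef y.1 k) : ℚ) : ℂ) •
        (L₂.map fun x => (((x.2.1 * rowCoef x.1 k) : ℚ) : ℂ) • Φ y.2.2 x.2.2).sum).sum := by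
    refine congrArg List.sum (List.map_congr_left fun y _ => ?_)
    rw [List.smul_sum, List.map_map]
    refine congrArg List.sum (List.map_congr_left fun x _ => ?_)
    simp only [Function.comp_def, Rat.cast_mul, mul_smul]
  rw [e2, sum_smul_fiber Λ' L₁ (fun y => y.2.2) (fun y => y.2.1 * rowCoef y.1 k)
    (fun v => (L₂.map fun x => (((x.2.1 * rowCoef x.1 k) : ℚ) : ℂ) • Φ v x.2.2).sum) V hV]
  refine Finset.sum_congr rfl fun v _ => ?_
  rw [sum_smul_fiber Λ' L₂ (fun x => x.2.2) (fun x => x.2.1 * rowCoef x.1 k) (fun w => Φ v w) W hW, Finset.smul_sum]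
  refine Finset.sum_congr rfl fun w _ => ?_
  rw [smul_smul, ← Rat.cast_mul]
  rfl

/-- `rowFastF` is `rowFastFη` over the tagged representative terms (the dot only reads the row). -/
theorem rowFastF_eq_tagRep (S : MomSpec M) (a : QPoly × List (ℚ × ℕ))
    (wmap : Std.HashMap M (List (List (ℚ × ℕ) × (ℚ × Word)))) (m s : ℚ) (T : List M) (P₂ : Word → Bool) :
    rowFastF S a wmap m s T P₂ = ((padj a.1).map fun t => (a.2, t)).flatMap fun y => rowFastFη S y wmap m s T P₂ := by
  rw [flatMap_map']; rfl

/-- `shareRWithMF` as a bucketed enumeration over `tagRep`. -/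
theorem shareRWithMF_eq_enum (S : MomSpec M) (K : SymCertR) (gbs : List (List QPoly)) (T : List M) (P₂ : Word → Bool) :
    shareRWithMF S K gbs T P₂ = (K.gramR.zip gbs).flatMap fun Bg =>
      (tagRep (Bg.1.reps.zip Bg.1.rows)).flatMap fun y =>
        rowFastFη S y (bucketOf S (wflat (Bg.2.zip Bg.1.rows))) Bg.1.moves.length Bg.1.scale T P₂ := by
  rw [shareRWithMF]
  congr 1
  funext Bg
  dsimp only
  rw [tagRep, flatMap_flatMap']
  congr 1
  funext a
  exact rowFastF_eq_tagRep S a _ _ _ T P₂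

omit [DecidableEq M] [Hashable M] in
theorem wflat_row {qr : List (QPoly × List (ℚ × ℕ))} {x : List (ℚ × ℕ) × (ℚ × Word)} (h : x ∈ wflat qr) :
    ∃ b ∈ qr, x.1 = b.2 ∧ x.2 ∈ b.1 := by
  rw [wflat, List.mem_flatMap] at h
  obtain ⟨b, hb, h⟩ := h
  rw [List.mem_map] at h
  obtain ⟨t, ht, rfl⟩ := h
  exact ⟨b, hb, rfl, ht⟩

/-- **The regrouping identity** (rows ascending): `polyOp Λ' (shareRWithMFη …) = polyOp Λ' (shareRWithMF …)`. -/
theorem polyOp_shareRWithMFη (S : MomSpec M) (K : SymCertR) (gbs : List (List QPoly)) (T : List M) (P₂ : Word → Bool)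
    (hAsc : ∀ B ∈ K.gramR, ∀ r ∈ B.rows, rowAsc r = true) (Λ' : Finset (Site 2)) :
    polyOp Λ' (shareRWithMFη le S K gbs T P₂) = polyOp Λ' (shareRWithMF S K gbs T P₂) := by
  classical
  rw [shareRWithMF_eq_enum, shareRWithMFη, polyOp_flatMap, polyOp_flatMap]
  refine congrArg List.sum (List.map_congr_left fun Bg hBg => ?_)
  have hB : Bg.1 ∈ K.gramR := (List.of_mem_zip hBg).1
  dsimp only
  rw [polyOp_enum_eq, polyOp_enum_eq]
  -- row facts: block rows are ascending with columns below `colBound`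
  have hrow : ∀ r ∈ Bg.1.rows, rowAsc r = true ∧ ∀ e ∈ r, e.2 < colBound (toGramBlock Bg.1) := fun r hr =>
    ⟨hAsc _ hB r hr, fun e he => lt_colBound (toGramBlock Bg.1) hr he⟩
  have hRT : ∀ y ∈ tagRep (Bg.1.reps.zip Bg.1.rows), rowAsc y.1 = true ∧ ∀ e ∈ y.1, e.2 < colBound (toGramBlock Bg.1) :=
    fun y hy => by
      obtain ⟨a, ha, h1, -⟩ := tagRep_row hy
      rw [h1]; exact hrow _ (List.of_mem_zip ha).2
  have hWT : ∀ x ∈ wflat (Bg.2.zip Bg.1.rows), rowAsc x.1 = true ∧ ∀ e ∈ x.1, e.2 < colBound (toGramBlock Bg.1) :=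
    fun x hx => by
      obtain ⟨b, hb, h1, -⟩ := wflat_row hx
      rw [h1]; exact hrow _ (List.of_mem_zip hb).2
  -- common word supersets
  let V : Finset Word := ((tagRep (Bg.1.reps.zip Bg.1.rows)).map fun y => y.2.2).toFinset ∪
    ((dgroup le (colBound (toGramBlock Bg.1)) (tagRep (Bg.1.reps.zip Bg.1.rows))).map fun y => y.2.2).toFinset
  let W : Finset Word := ((wflat (Bg.2.zip Bg.1.rows)).map fun x => x.2.2).toFinset ∪
    ((dgroup le (colBound (toGramBlock Bg.1)) (wflat (Bg.2.zip Bg.1.rows))).map fun x => x.2.2).toFinset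
  have hV₁ : ∀ y ∈ tagRep (Bg.1.reps.zip Bg.1.rows), y.2.2 ∈ V := fun y hy =>
    Finset.mem_union_left _ (List.mem_toFinset.2 (List.mem_map.2 ⟨y, hy, rfl⟩))
  have hV₂ : ∀ y ∈ dgroup le (colBound (toGramBlock Bg.1)) (tagRep (Bg.1.reps.zip Bg.1.rows)), y.2.2 ∈ V := fun y hy =>
    Finset.mem_union_right _ (List.mem_toFinset.2 (List.mem_map.2 ⟨y, hy, rfl⟩))
  have hW₁ : ∀ x ∈ wflat (Bg.2.zip Bg.1.rows), x.2.2 ∈ W := fun x hx =>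
    Finset.mem_union_left _ (List.mem_toFinset.2 (List.mem_map.2 ⟨x, hx, rfl⟩))
  have hW₂ : ∀ x ∈ dgroup le (colBound (toGramBlock Bg.1)) (wflat (Bg.2.zip Bg.1.rows)), x.2.2 ∈ W := fun x hx =>
    Finset.mem_union_right _ (List.mem_toFinset.2 (List.mem_map.2 ⟨x, hx, rfl⟩))
  rw [enum_sum_eq_theta Λ' _ _ _ (dgroup_rows le) (dgroup_rows le) V W hV₂ hW₂,
    enum_sum_eq_theta Λ' _ _ _ hRT hWT V W hV₁ hW₁]
  refine Finset.sum_congr rfl fun k hk => Finset.sum_congr rfl fun v _ => Finset.sum_congr rfl fun w _ => ?_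
  rw [wmu_dgroup le _ _ v (Finset.mem_range.1 hk), wmu_dgroup le _ _ w (Finset.mem_range.1 hk)]

/-- The sub-module share by word-level rows has the operator value of `shareRFastMF`'s. -/
theorem polyOp_shareRFastMFη (S : MomSpec M) (K : SymCertR) (gbs : List (List QPoly)) (hm : MomTable M) (κ₂ : Word → ℕ)
    (J L i f : ℕ) (hAsc : ∀ B ∈ K.gramR, ∀ r ∈ B.rows, rowAsc r = true) (Λ' : Finset (Site 2)) :
    polyOp Λ' (shareRFastMFη le S K gbs hm κ₂ J L i f) = polyOp Λ' (shareRFastMF S K gbs hm κ₂ J L i f) := by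
  simp only [shareRFastMFη, shareRFastMF, polyOp_append, polyOp_shareRWithMFη le S K gbs _ _ hAsc]

/-! ##### (c) Word inclusion (`hW`) and the closing over `J·L` modules through the tree's semantic skeleton -/

omit [DecidableEq M] [Hashable M] in
/-- **Rows of every R-block of a well-formed certificate are ascending** — hub-lb-sym-ref-2 g2's finding + lemma (pub
`hub-lb-sym-ref-2/g2/lean/HAscOfWellFormed.lean` d88a8020e5414e0e, verbatim): `SymCertR.expand` appends `K.gramR.map toGramBlock`
to `gramM`, `toGramBlock` keeps `rows`, and `gramBlockOK`'s clause `rows.all rowAsc` is checked by `wellFormed`.  So the η closings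
take `…PMF0`'s binder list EXACTLY — no rows-ascending side fact, not even one `decide`. -/
theorem rowsAsc_of_wellFormed (K : SymCertR) (hwf : wellFormed K.expand = true) :
    ∀ B ∈ K.gramR, ∀ r ∈ B.rows, rowAsc r = true := by
  simp only [wellFormed, SymCertR.expand, Bool.and_eq_true] at hwf
  obtain ⟨⟨⟨⟨⟨⟨⟨⟨⟨⟨⟨⟨⟨_, _⟩, _⟩, _⟩, _⟩, _⟩, hgM⟩, _⟩, _⟩, _⟩, _⟩, _⟩, _⟩, _⟩ := hwf
  intro B hB r hr
  have h := List.all_eq_true.1 hgM (toGramBlock B) (List.mem_append_right _ (List.mem_map.2 ⟨B, hB, rfl⟩))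
  simp only [gramBlockOK, Bool.and_eq_true, decide_eq_true_eq, List.all_eq_true] at h
  exact h.1.2 r hr

omit [DecidableEq M] [Hashable M] in
/-- A nonzero list sum has a nonzero summand. -/
theorem exists_ne_zero_of_list_sum_ne_zero {α N : Type*} [AddMonoid N] (l : List α) (f : α → N)
    (h : (l.map f).sum ≠ 0) : ∃ a ∈ l, f a ≠ 0 := by
  by_contra hc
  push Not at hc
  exact h (List.sum_eq_zero fun q hq => by
    obtain ⟨a, ha, rfl⟩ := List.mem_map.1 hq
    exact hc a ha)

omit [DecidableEq M] [Hashable M] in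
/-- Product of two list sums as a double list sum. -/
theorem list_sum_mul_list_sum {α β : Type*} (l₁ : List α) (l₂ : List β) (f : α → ℚ) (g : β → ℚ) :
    (l₁.map f).sum * (l₂.map g).sum = (l₁.map fun a => (l₂.map fun b => f a * g b).sum).sum := by
  rw [← List.sum_map_mul_right]
  exact congrArg List.sum (List.map_congr_left fun a _ => by rw [List.sum_map_mul_left])

omit [DecidableEq M] [Hashable M] in
/-- **The dot of two word-level rows, expanded over their groups**: `⟨ρ_ch, ρ_ch'⟩ = Σ_{y ∈ ch} Σ_{x ∈ ch'} c_y c_x ⟨L_y, L_x⟩`. -/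
theorem sdot_drow_drow (n : ℕ) (ch ch' : List (List (ℚ × ℕ) × (ℚ × Word)))
    (h₁ : ∀ y ∈ ch, rowAsc y.1 = true ∧ ∀ e ∈ y.1, e.2 < n) (h₂ : ∀ x ∈ ch', rowAsc x.1 = true ∧ ∀ e ∈ x.1, e.2 < n) :
    sdot (drow n ch) (drow n ch') = (ch.map fun y => (ch'.map fun x => y.2.1 * x.2.1 * sdot y.1 x.1).sum).sum := by
  rw [sdot_eq_sum n _ _ (rowAsc_drow n ch) (rowAsc_drow n ch') (drow_bound n ch) (drow_bound n ch'),
    Fin.sum_univ_eq_sum_range (fun k => rowCoef (drow n ch) k * rowCoef (drow n ch') k) n]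
  have e1 : (ch.map fun y => (ch'.map fun x => y.2.1 * x.2.1 * sdot y.1 x.1).sum).sum =
      (ch.map fun y => (ch'.map fun x =>
        ∑ k ∈ Finset.range n, (y.2.1 * rowCoef y.1 k) * (x.2.1 * rowCoef x.1 k)).sum).sum := by
    refine congrArg List.sum (List.map_congr_left fun y hy => congrArg List.sum (List.map_congr_left fun x hx => ?_))
    rw [sdot_eq_sum n y.1 x.1 (h₁ y hy).1 (h₂ x hx).1 (h₁ y hy).2 (h₂ x hx).2,
      Fin.sum_univ_eq_sum_range (fun k => rowCoef y.1 k * rowCoef x.1 k) n, Finset.mul_sum]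
    exact Finset.sum_congr rfl fun k _ => by ring
  rw [e1]
  simp only [list_sum_map_finset_sum]
  refine Finset.sum_congr rfl fun k hk => ?_
  rw [rowCoef_drow n ch (Finset.mem_range.1 hk), rowCoef_drow n ch' (Finset.mem_range.1 hk), list_sum_mul_list_sum]

/-- **Word inclusion, block level**: every word emitted by the η enumeration of a block is emitted by the MF enumeration of
the same block — from `⟨ρ_u, σ_w⟩ ≠ 0` extract a pair `(i ∋ u, j ∋ w)` with `⟨L_i, L_j⟩ ≠ 0` (`sdot_drow_drow` + a nonzero
summand), whose MF product hit emits `u ++ w`. -/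
theorem words_enumη (S : MomSpec M) (L₁ L₂ : List (List (ℚ × ℕ) × (ℚ × Word))) (n : ℕ)
    (h₁ : ∀ y ∈ L₁, rowAsc y.1 = true ∧ ∀ e ∈ y.1, e.2 < n) (h₂ : ∀ x ∈ L₂, rowAsc x.1 = true ∧ ∀ e ∈ x.1, e.2 < n)
    (m s : ℚ) (T : List M) (P₂ : Word → Bool) :
    ∀ t ∈ (dgroup le n L₁).flatMap (fun y => rowFastFη S y (bucketOf S (dgroup le n L₂)) m s T P₂),
      ∃ t' ∈ L₁.flatMap (fun y => rowFastFη S y (bucketOf S L₂) m s T P₂), t'.2 = t.2 := by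
  intro t ht
  rw [List.mem_flatMap] at ht
  obtain ⟨y, hy, ht⟩ := ht
  rw [rowFastFη, List.mem_flatMap] at ht
  obtain ⟨mt, hmt, ht⟩ := ht
  rw [List.mem_filterMap] at ht
  obtain ⟨x, hx, hxt⟩ := ht
  rw [bucketOf_getD, List.mem_reverse, List.mem_filter, decide_eq_true_eq] at hx
  obtain ⟨hx, hmom⟩ := hx
  simp only [stepOpt] at hxt
  split_ifs at hxt with hP h0
  simp only [Option.some.injEq] at hxt
  -- the groups behind `y` and `x`; their words are constant
  obtain ⟨ch, hch, hy1, y₁, hy₁, -, hy2⟩ := mem_dgroup le hy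
  obtain ⟨ch', hch', hx1, x₁, hx₁, -, hx2⟩ := mem_dgroup le hx
  have hchw : ∀ y₀ ∈ ch, y₀.2.2 = y.2.2 := fun y₀ hy₀ => by
    rw [hy2]; exact (wgroup_spec le L₁ ch hch).2 y₀ hy₀ y₁ hy₁
  have hchw' : ∀ x₀ ∈ ch', x₀.2.2 = x.2.2 := fun x₀ hx₀ => by
    rw [hx2]; exact (wgroup_spec le L₂ ch' hch').2 x₀ hx₀ x₁ hx₁
  have hrows : ∀ y₀ ∈ ch, rowAsc y₀.1 = true ∧ ∀ e ∈ y₀.1, e.2 < n := fun y₀ hy₀ => h₁ y₀ (mem_of_mem_wgroup le hch hy₀)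
  have hrows' : ∀ x₀ ∈ ch', rowAsc x₀.1 = true ∧ ∀ e ∈ x₀.1, e.2 < n := fun x₀ hx₀ =>
    h₂ x₀ (mem_of_mem_wgroup le hch' hx₀)
  -- witness extraction
  rw [hy1, hx1, sdot_drow_drow n ch ch' hrows hrows'] at h0
  obtain ⟨y₀, hy₀, h0⟩ := exists_ne_zero_of_list_sum_ne_zero _ _ h0
  obtain ⟨x₀, hx₀, h0⟩ := exists_ne_zero_of_list_sum_ne_zero _ _ h0
  have hd : sdot y₀.1 x₀.1 ≠ 0 := by
    intro h
    refine h0 ?_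
    rw [h, mul_zero]
  have hP' : P₂ (y₀.2.2 ++ x₀.2.2) = true := by rw [hchw y₀ hy₀, hchw' x₀ hx₀]; exact hP
  -- the MF term of the pair `(y₀, x₀)`
  refine ⟨(-1 * (m * (s * sdot y₀.1 x₀.1)) * (y₀.2.1 * x₀.2.1), y₀.2.2 ++ x₀.2.2), ?_, ?_⟩
  · rw [List.mem_flatMap]
    refine ⟨y₀, mem_of_mem_wgroup le hch hy₀, ?_⟩
    rw [rowFastFη, List.mem_flatMap]
    refine ⟨mt, hmt, ?_⟩
    rw [List.mem_filterMap]
    refine ⟨x₀, ?_, ?_⟩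
    · rw [bucketOf_getD, List.mem_reverse, List.mem_filter, decide_eq_true_eq]
      exact ⟨mem_of_mem_wgroup le hch' hx₀, by rw [hchw' x₀ hx₀, hchw y₀ hy₀]; exact hmom⟩
    · rw [if_pos hP']
      simp only [stepOpt]
      rw [if_neg hd]
  · rw [← hxt]
    show y₀.2.2 ++ x₀.2.2 = y.2.2 ++ x.2.2
    rw [hchw y₀ hy₀, hchw' x₀ hx₀]

/-- Block rows behind the tagged representative terms: ascending, columns `< colBound`. -/
theorem tagRep_rows {K : SymCertR} (hAsc : ∀ B ∈ K.gramR, ∀ r ∈ B.rows, rowAsc r = true) {B : GramBlockR}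
    (hB : B ∈ K.gramR) :
    ∀ y ∈ tagRep (B.reps.zip B.rows), rowAsc y.1 = true ∧ ∀ e ∈ y.1, e.2 < colBound (toGramBlock B) := fun y hy => by
  obtain ⟨a, ha, h1, -⟩ := tagRep_row hy
  rw [h1]
  exact ⟨hAsc _ hB _ (List.of_mem_zip ha).2, fun e he => lt_colBound (toGramBlock B) (List.of_mem_zip ha).2 he⟩

omit [DecidableEq M] [Hashable M] in
/-- Block rows behind the tagged basis terms: ascending, columns `< colBound`. -/
theorem wflat_rows {K : SymCertR} (hAsc : ∀ B ∈ K.gramR, ∀ r ∈ B.rows, rowAsc r = true) {B : GramBlockR}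
    (hB : B ∈ K.gramR) (qs : List QPoly) :
    ∀ x ∈ wflat (qs.zip B.rows), rowAsc x.1 = true ∧ ∀ e ∈ x.1, e.2 < colBound (toGramBlock B) := fun x hx => by
  obtain ⟨b, hb, h1, -⟩ := wflat_row hx
  rw [h1]
  exact ⟨hAsc _ hB _ (List.of_mem_zip hb).2, fun e he => lt_colBound (toGramBlock B) (List.of_mem_zip hb).2 he⟩

/-- **Word inclusion for the R-part** (rows ascending). -/
theorem words_shareRWithMFη (S : MomSpec M) (K : SymCertR) (gbs : List (List QPoly)) (T : List M) (P₂ : Word → Bool)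
    (hAsc : ∀ B ∈ K.gramR, ∀ r ∈ B.rows, rowAsc r = true) :
    ∀ t ∈ shareRWithMFη le S K gbs T P₂, ∃ t' ∈ shareRWithMF S K gbs T P₂, t'.2 = t.2 := by
  intro t ht
  rw [shareRWithMFη, List.mem_flatMap] at ht
  obtain ⟨Bg, hBg, ht⟩ := ht
  dsimp only at ht
  have hB : Bg.1 ∈ K.gramR := (List.of_mem_zip hBg).1
  obtain ⟨t', ht', he⟩ :=
    words_enumη le S _ _ _ (tagRep_rows hAsc hB) (wflat_rows hAsc hB Bg.2) _ _ T P₂ t ht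
  refine ⟨t', ?_, he⟩
  rw [shareRWithMF_eq_enum, List.mem_flatMap]
  exact ⟨Bg, hBg, ht'⟩

/-- **Word inclusion for the sub-module share**: every word of `shareRFastMFη … i f` is a word of `shareRFastMF … i f`. -/
theorem words_shareRFastMFη (S : MomSpec M) (K : SymCertR) (gbs : List (List QPoly)) (hm : MomTable M) (κ₂ : Word → ℕ)
    (J L i f : ℕ) (hAsc : ∀ B ∈ K.gramR, ∀ r ∈ B.rows, rowAsc r = true) :
    ∀ t ∈ shareRFastMFη le S K gbs hm κ₂ J L i f, ∃ t' ∈ shareRFastMF S K gbs hm κ₂ J L i f, t'.2 = t.2 := by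
  intro t ht
  simp only [shareRFastMFη, List.mem_append] at ht
  rcases ht with ht | ht | ht
  · exact ⟨t, by simp only [shareRFastMF, List.mem_append]; exact Or.inl ht, rfl⟩
  · exact ⟨t, by simp only [shareRFastMF, List.mem_append]; exact Or.inr (Or.inl ht), rfl⟩
  · obtain ⟨t', ht', he⟩ := words_shareRWithMFη le S K gbs _ _ hAsc t ht
    exact ⟨t', by simp only [shareRFastMF, List.mem_append]; exact Or.inr (Or.inr ht'), he⟩

/-- **Hierarchical routing, word-level factor rows, bare packed facts (`J·L` modules), closed through the TREE's semantic
skeleton `energyDensity_ge_of_outroutePSem0`** (`hW` = `words_shareRFastMFη` + `shareRFastMF_perm_lin`; `hsem` =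
`polyOp_shareRFastMFη` + `polyOp_perm`): per module `m < J·L` one file
`out_m : PackedNF.pisZero (PackedNF.pcanonNFZHBZ lo hi oP (PackedNF.encP lo hi (shareRFastMFη le Sm K (K.gramR.map genBasis) hm
κ₂ J L (m / L) (m % L)))) = true := by native_decide`; hypotheses = `…PMF0`'s EXACTLY (+ the comparator `le`). -/
theorem energyDensity_ge_of_outroutePMFη0 {Mo : Type} [DecidableEq Mo] [Hashable Mo] (Sm : MomSpec Mo) (K : SymCertR)
    (hwf : wellFormed K.expand = true) (hRok : K.gramR.all (gramBlockROK K.frame) = true)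
    (oP : PackedNF.PWord → PackedNF.PHint) (hm : MomTable Mo)
    (κ₂ : Word → ℕ) (J L : ℕ) (hJ : 0 < J) (hL : 0 < L) (lo hi : ℤ × ℤ) (hbox : boxLicence K.frame lo hi = true)
    (hcov : coverM Sm K (K.gramR.map genBasis) hm = true)
    (hfacts : OutFactsP0 lo hi oP (fun m => shareRFastMFη le Sm K (K.gramR.map genBasis) hm κ₂ J L (m / L) (m % L)) 0 (J * L)) :
    ((symValueR K : ℚ) : ℝ) ≤ energyDensityTT' 1 0 8 (7 / 8) :=
  energyDensity_ge_of_outroutePSem0 K hwf hRok oP (momKey₂ Sm hm κ₂ J L) (J * L) (Nat.mul_pos hJ hL) _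
    (fun m _ t ht => by
      obtain ⟨t', ht', he⟩ := words_shareRFastMFη le Sm K _ hm κ₂ J L _ _ (rowsAsc_of_wellFormed K hwf) t ht
      exact ⟨t', (shareRFastMF_perm_lin Sm K hm κ₂ hJ hL hcov m).mem_iff.1 ht', he⟩)
    (fun Λ' m _ => by
      rw [polyOp_shareRFastMFη le Sm K _ hm κ₂ J L _ _ (rowsAsc_of_wellFormed K hwf) Λ']
      exact polyOp_perm Λ' (shareRFastMF_perm_lin Sm K hm κ₂ hJ hL hcov m))
    lo hi hbox hfacts

/-! ##### (d) ENGINE FORM of the word-level rows: `drowA` (one `Array` scatter-accumulate per group) = `drow` -/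

/-- Scatter-accumulate `c · r` (columns `< n`) into a dense accumulator of width `n`. -/
def scat (n : ℕ) (c : ℚ) (a : Array ℚ) (r : List (ℚ × ℕ)) : Array ℚ :=
  r.foldl (fun a e => if e.2 < n then a.modify e.2 (fun q => q + c * e.1) else a) a

/-- The dense accumulator `Σ_{(L,(c,·)) ∈ ch} c · L` of a group (width `n`). -/
def dacc (n : ℕ) (ch : List (List (ℚ × ℕ) × (ℚ × Word))) : Array ℚ :=
  ch.foldl (fun a y => scat n y.2.1 a y.1) (Array.replicate n 0)

/-- **ENGINE form of `drow`**: cost `Σ_{y ∈ ch} |L_y| + n` instead of `n · |ch| · |L|`. -/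
def drowA (n : ℕ) (ch : List (List (ℚ × ℕ) × (ℚ × Word))) : List (ℚ × ℕ) :=
  let a := dacc n ch      -- HOISTED: one accumulator per group (hub-lb-sym-eng-3 g4 bench l.2236: ×18 on rung V without the `let`)
  (List.range n).map fun k => ((a[k]?).getD 0, k)

omit [DecidableEq M] [Hashable M] in
theorem drowA_def (n : ℕ) (ch : List (List (ℚ × ℕ) × (ℚ × Word))) :
    drowA n ch = (List.range n).map fun k => (((dacc n ch)[k]?).getD 0, k) := rfl

omit [DecidableEq M] [Hashable M] in
/-- `rowCoef` of a cons (pair form of the tree's `rowCoef_cons`). -/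
theorem rowCoef_cons' (e : ℚ × ℕ) (r : List (ℚ × ℕ)) (k : ℕ) :
    rowCoef (e :: r) k = (if e.2 = k then e.1 else 0) + rowCoef r k := by
  rw [rowCoef, rowCoef, List.map_cons, List.sum_cons]

omit [DecidableEq M] [Hashable M] in
/-- The scatter step adds `c · rowCoef r` column-wise. -/
theorem scat_spec (n : ℕ) (c : ℚ) : ∀ (r : List (ℚ × ℕ)) (a : Array ℚ) (f : ℕ → ℚ),
    (∀ k, a[k]? = if k < n then some (f k) else none) →
      ∀ k, (scat n c a r)[k]? = if k < n then some (f k + c * rowCoef r k) else none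
  | [], a, f, ha => fun k => by rw [scat, List.foldl_nil, ha k]; simp [rowCoef]
  | e :: r, a, f, ha => by
    intro k
    rw [scat, List.foldl_cons, ← scat, rowCoef_cons', mul_add, ← add_assoc]
    refine scat_spec n c r _ (fun k => f k + c * (if e.2 = k then e.1 else 0)) ?_ k
    intro k'
    by_cases hlt : e.2 < n
    · rw [if_pos hlt, Array.getElem?_modify, ha k']
      by_cases he : e.2 = k'
      · subst he
        rw [if_pos rfl, if_pos hlt, if_pos hlt, if_pos rfl, Option.map_some]
      · rw [if_neg he, if_neg he, mul_zero, add_zero]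
    · rw [if_neg hlt, ha k']
      by_cases hk : k' < n
      · rw [if_pos hk, if_pos hk, if_neg (by rintro rfl; exact hlt hk), mul_zero, add_zero]
      · rw [if_neg hk, if_neg hk]

omit [DecidableEq M] [Hashable M] in
/-- The accumulator holds the word-level row column-wise. -/
theorem dacc_spec (n : ℕ) : ∀ (ch : List (List (ℚ × ℕ) × (ℚ × Word))) (a : Array ℚ) (f : ℕ → ℚ),
    (∀ k, a[k]? = if k < n then some (f k) else none) →
      ∀ k, (ch.foldl (fun a y => scat n y.2.1 a y.1) a)[k]? =
        if k < n then some (f k + (ch.map fun y => y.2.1 * rowCoef y.1 k).sum) else none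
  | [], a, f, ha => fun k => by rw [List.foldl_nil, ha k, List.map_nil, List.sum_nil, add_zero]
  | y :: ch, a, f, ha => fun k => by
    rw [List.foldl_cons, dacc_spec n ch _ _ (scat_spec n y.2.1 y.1 a f ha) k, List.map_cons, List.sum_cons, add_assoc]

omit [DecidableEq M] [Hashable M] in
/-- **The engine form IS the spec form** (unconditionally: `rowCoef` sums all entries of a column). -/
theorem drowA_eq_drow (n : ℕ) (ch : List (List (ℚ × ℕ) × (ℚ × Word))) : drowA n ch = drow n ch := by
  rw [drowA_def, drow]
  refine List.map_congr_left fun k hk => ?_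
  have h := dacc_spec n ch (Array.replicate n 0) (fun _ => 0) (fun k => by
    rw [Array.getElem?_replicate]) k
  rw [dacc, h, if_pos (List.mem_range.1 hk), zero_add, Option.getD_some]

/-- Kernel sanity models (for the referees' `decide` legs): engine and spec rows agree on a toy group of two tagged
terms sharing one word (coefficients `2`, `-1`), both summing the shared column `2`; width `3` keeps the empty column `1`. -/
example : drowA 3 [([((1 : ℚ) / 2, 0), (1, 2)], (2, ([] : Word))), ([(3, 2)], (-1, ([] : Word)))] =
    [(1, 0), (0, 1), (-1, 2)] := by decide +kernel
example : drow 3 [([((1 : ℚ) / 2, 0), (1, 2)], (2, ([] : Word))), ([(3, 2)], (-1, ([] : Word)))] =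
    [(1, 0), (0, 1), (-1, 2)] := by decide +kernel

/-- Engine form of `dhead` / `dgroup` / the η enumerator (`…A`), each equal to its spec form. -/
def dheadA (n : ℕ) : List (List (ℚ × ℕ) × (ℚ × Word)) → Option (List (ℚ × ℕ) × (ℚ × Word))
  | [] => none
  | y :: ys => some (drowA n (y :: ys), ((1 : ℚ), y.2.2))

def dgroupA (n : ℕ) (L : List (List (ℚ × ℕ) × (ℚ × Word))) : List (List (ℚ × ℕ) × (ℚ × Word)) :=
  (wgroup le L).filterMap (dheadA n)

omit [DecidableEq M] [Hashable M] in
theorem dgroupA_eq (n : ℕ) (L : List (List (ℚ × ℕ) × (ℚ × Word))) : dgroupA le n L = dgroup le n L := by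
  rw [dgroupA, dgroup]
  congr 1
  funext ch
  cases ch with
  | nil => rfl
  | cons y ys => rw [dheadA, dhead, drowA_eq_drow]

/-- **ENGINE η R-part** (`drowA` rows). -/
def shareRWithMFηA (S : MomSpec M) (K : SymCertR) (gbs : List (List QPoly)) (T : List M) (P₂ : Word → Bool) : QPoly :=
  (K.gramR.zip gbs).flatMap fun Bg =>
    let n := colBound (toGramBlock Bg.1)
    let wmap := bucketOf S (dgroupA le n (wflat (Bg.2.zip Bg.1.rows)))
    (dgroupA le n (tagRep (Bg.1.reps.zip Bg.1.rows))).flatMap fun y => rowFastFη S y wmap Bg.1.moves.length Bg.1.scale T P₂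

/-- **ENGINE η sub-module share** — the function a module file evaluates. -/
def shareRFastMFηA (S : MomSpec M) (K : SymCertR) (gbs : List (List QPoly)) (hm : MomTable M) (κ₂ : Word → ℕ)
    (J L i f : ℕ) : QPoly :=
  let P := wordPred (inSlotW (momKey S hm) J i)
  let P₂ : Word → Bool := fun w => κ₂ w % L == f
  (baseShareF K.toSymCert P).filter (wordPred P₂) ++
  ((pscale (-1) (K.gramM.flatMap fun B => (gramBlockPoly B).filter P)).filter (wordPred P₂) ++
    shareRWithMFηA le S K gbs (targetsM hm J i) P₂)

theorem shareRWithMFηA_eq (S : MomSpec M) (K : SymCertR) (gbs : List (List QPoly)) (T : List M) (P₂ : Word → Bool) :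
    shareRWithMFηA le S K gbs T P₂ = shareRWithMFη le S K gbs T P₂ := by
  simp only [shareRWithMFηA, shareRWithMFη, dgroupA_eq]

/-- **The engine share IS the spec share** (list equality; so its packed facts are the spec share's facts). -/
theorem shareRFastMFηA_eq (S : MomSpec M) (K : SymCertR) (gbs : List (List QPoly)) (hm : MomTable M) (κ₂ : Word → ℕ)
    (J L i f : ℕ) : shareRFastMFηA le S K gbs hm κ₂ J L i f = shareRFastMFη le S K gbs hm κ₂ J L i f := by
  simp only [shareRFastMFηA, shareRFastMFη, shareRWithMFηA_eq]

/-- **The closing on the ENGINE share** (per module `m < J·L` one file `… (shareRFastMFηA le Sm K (K.gramR.map genBasis) hm κ₂ J L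
(m / L) (m % L)) … = true := by native_decide`); hypotheses = `energyDensity_ge_of_outroutePMFη0`'s. -/
theorem energyDensity_ge_of_outroutePMFηA0 {Mo : Type} [DecidableEq Mo] [Hashable Mo] (Sm : MomSpec Mo) (K : SymCertR)
    (hwf : wellFormed K.expand = true) (hRok : K.gramR.all (gramBlockROK K.frame) = true)
    (oP : PackedNF.PWord → PackedNF.PHint) (hm : MomTable Mo)
    (κ₂ : Word → ℕ) (J L : ℕ) (hJ : 0 < J) (hL : 0 < L) (lo hi : ℤ × ℤ) (hbox : boxLicence K.frame lo hi = true)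
    (hcov : coverM Sm K (K.gramR.map genBasis) hm = true)
    (hfacts : OutFactsP0 lo hi oP (fun m => shareRFastMFηA le Sm K (K.gramR.map genBasis) hm κ₂ J L (m / L) (m % L)) 0 (J * L)) :
    ((symValueR K : ℚ) : ℝ) ≤ energyDensityTT' 1 0 8 (7 / 8) := by
  simp only [shareRFastMFηA_eq] at hfacts
  exact energyDensity_ge_of_outroutePMFη0 le Sm K hwf hRok oP hm κ₂ J L hJ hL lo hi hbox hcov hfacts

end Eta

end Summit.Ventures.CertifiedManyBodySolver.Theorems.SymReplay
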